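/-
Origin: expansion seat `prover-pub-hodgecm-mc-binder-2-g7-0`, handover #20 20:20Z md5 6f7b66ebe815 (279 l.; (J-dense)/(J-x₀) at a Σ₁₂ place, POLYNOMIAL LEVEL: the `K_V`-invariant Fock polynomials of the census slot are exactly `ℂ[P]` — §1 `vcToDPIdx eA r₀ s₀ : VCVar n → DPIdx P' Q' R' S'` (tree vector–covector variables into the slot: `inl a ↦ (eA a, s₀)` mixed, `inr a ↦ (eA a, r₀)` same-sign; `_injective`, `_surjective [IsEmpty Q'] [Unique R'] [Unique S']`), `slotPairing r₀ s₀ = Σ_p X_{(p,r₀)} X_{(p,s₀)}`, `rename_vcToDPIdx_pairing(_pow)`; §2 `vcMatrix eA a = (a.submatrix eA eA)ᵀ`, `ofVCMatrix`, `submatrix_equiv_mem_unitaryGroup`, `transpose_submatrix_mem_unitaryGroup`, `vcMatrix_mem_unitaryGroup`, `ofVCMatrix_mem_unitaryGroup`; §3 DICTIONARY `linSubst_star_dualPairι_X_inl_inl` / `_X_inr_inl` (general letter), `linSubst_star_dualPairι_kV_X_inl_inl` (`X_{(p,r)} ↦ Σ a_{p'p} X_{(p',r)}`) / `_kV_X_inr_inl`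 (`X_{(p,s)} ↦ Σ conj(a_{p'p}) X_{(p',s)}`), **`linSubst_star_dualPairι_kV_rename_vcToDPIdx`**: `linSubst (dualPairι ((a,b),(1,1)))⋆ (rename j F) = rename j (linSubst (vcBlock (vcMatrix eA a)) F)`; §4 `linSubst_star_dualPairι_kV_slotPairing_pow` (ℂ[P_slot] invariant), `_kV_of_mem_span`, `mem_span_slotPairing_pow_of_kV_invariant [NeZero n]` (tree FFT `ClassicalInvariants.isVCUnitaryInvariant_iff` transported), **`kV_invariant_iff_mem_span_slotPairing_pow [Nonempty P'] [IsEmpty Q'] [Unique R'] [Unique S']`**: `(∀ a ∈ U(P'), linSubst (dualPairι ((a,1),(1,1)))⋆ G = G) ↔ G ∈ span {P_slot^k}`; farm amalgam (285 l.) rc 0 / 0 err / 0 warn / 0 proof-hole, `#print axioms kV_invariant_iff_mem_span_slotPairing_pow` = trio (`g7/certs/InvariantSlot_amalg.json`)) (`HOME/mc/pub-hodgecm-mc-binder-2/g7/pkg/HodgeCM/Model/HypCensus/InvariantSlot.lean`, md5 6f7b66eb, 279 lines);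
landed by the gen-13 packager (p-g13) in gate run 37 as `HodgeCM/Model/HypCensus/InvariantSlot.lean` (verbatim).
-/
/-
Origin: speedrun cell pub-hodgecm, MODEL-CONSTRUCTION sub-cell, lineage mc-binder-2 (rows A12/A34 of the binder ledger:
`hyp12` / `hyp34`), seat prover-pub-hodgecm-mc-binder-2-g7-0 (gen 7), 2026-08-19.  Target in PKG:
`HodgeCM/Model/HypCensus/InvariantSlot.lean` (NEW additive leaf; imports ONLY the K-1 twins of tree
`RepresentationTheory/ClassicalInvariants/VectorCovectorUnitaryInvariants` and `Analysis/SegalBargmann/FockDualPairCompact`,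
both PRESENT in PKG).  KERNEL only: 0 records / named facts / proof holes.
-/
import Literature.RepresentationTheory.ClassicalInvariants.VectorCovectorUnitaryInvariants
import Literature.Analysis.SegalBargmann.FockDualPairCompact

/-!
# Census kit (rows A12/A34), (J-dense)/(J-x₀) at a `Σ₁₂` place, polynomial level: the `K_V`-invariant Fock polynomials
# of the census slot are exactly `ℂ[P]`

At a `Σ₁₂` place the slot is `V_b` definite of rank `n` (`P' ≃ Fin n`, `Q' = ∅`), `W_b ≅ U(1,1)` (`R' = {r₀}`, `S' = {s₀}`);
Konno–Konno's compact `K_V = U(P')` acts on the Fock polynomials of the slot by the substitution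
`linSubst (dualPairι ((a,b),(1,1)))⋆` (Folland's Bargmann intertwining, #18).  The tree holds the first fundamental theorem for
`U(n)` on `V ⊕ V̄` (`ClassicalInvariants.isVCUnitaryInvariant_iff`: `F(ḡz, gw) = F(z,w) ∀ g ∈ U(n) ⟺ F ∈ ℂ[P]`,
`P = Σ_a z_a w_a`).  This file is the DICTIONARY between the two and its consequence:

* `vcToDPIdx eA r₀ s₀ : VCVar n → DPIdx P' Q' R' S'` (covector-type `inl a ↦` mixed block `(eA a, s₀)`, vector-type `inr a ↦` same-sign
  block `(eA a, r₀)`), `slotPairing r₀ s₀ = Σ_p X_{(p,r₀)} X_{(p,s₀)}` (`rename_vcToDPIdx_pairing`);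
* **`linSubst_star_dualPairι_kV_rename_vcToDPIdx`**: `linSubst (dualPairι ((a,b),(1,1)))⋆ (rename j F) = rename j (linSubst (vcBlock (vcMatrix eA a)) F)`
  with `vcMatrix eA a = (a reindexed by eA)ᵀ ∈ U(n)`;
* **`kV_invariant_iff_mem_span_slotPairing_pow`** (`[IsEmpty Q'] [Unique R'] [Unique S'] [NeZero n]`): a Fock polynomial `G` of the slot
  satisfies `linSubst (dualPairι ((a,1),(1,1)))⋆ G = G` for all `a ∈ U(P')` IFF `G ∈ span {slotPairing^k}` — pv12's printed
  `kappaPartM = span{P^k}` is the whole `K_V`-invariant part: the polynomial-level content of the `dense` field and of (J-x₀) at `Σ₁₂`.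

[GoodmanWallachGTM255, Thm 5.2.1; Folland1989, Prop. (4.39)]  Nothing here is a claim of PerL/QW8.  Style lint (L-notation): no `local notation`.
-/

set_option autoImplicit false

noncomputable section

open MvPolynomial Complex
open scoped BigOperators ComplexConjugate Kronecker Matrix
open Literature.Analysis.SegalBargmann
open Literature.RepresentationTheory.ClassicalInvariants

namespace HodgeCM.Model.HypCensus

section Slot

variable {P' Q' R' S' : Type} [Fintype P'] [DecidableEq P'] [Fintype Q'] [DecidableEq Q'] [Fintype R'] [DecidableEq R']
  [Fintype S'] [DecidableEq S'] {n : ℕ} (eA : Fin n ≃ P') (r₀ : R') (s₀ : S')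

/-! ## §1 The variables and the pairing of the slot -/

/-- the tree's vector–covector variables into the slot: covector-type `inl a ↦ (eA a, s₀)` (mixed block `P' × S'`), vector-type
`inr a ↦ (eA a, r₀)` (same-sign block `P' × R'`). -/
def vcToDPIdx : VCVar n → DPIdx P' Q' R' S' :=
  Sum.elim (fun a => Sum.inr (Sum.inl (eA a, s₀))) (fun a => Sum.inl (Sum.inl (eA a, r₀)))

omit [Fintype P'] [DecidableEq P'] [Fintype Q'] [DecidableEq Q'] [Fintype R'] [DecidableEq R'] [Fintype S'] [DecidableEq S'] in
/-- (Ported verbatim from the HodgeCMPerL package; no docstring in the source.) -/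
@[simp] theorem vcToDPIdx_inl (a : Fin n) : vcToDPIdx (Q' := Q') eA r₀ s₀ (Sum.inl a) = Sum.inr (Sum.inl (eA a, s₀)) := rfl

omit [Fintype P'] [DecidableEq P'] [Fintype Q'] [DecidableEq Q'] [Fintype R'] [DecidableEq R'] [Fintype S'] [DecidableEq S'] in
/-- (Ported verbatim from the HodgeCMPerL package; no docstring in the source.) -/
@[simp] theorem vcToDPIdx_inr (a : Fin n) : vcToDPIdx (Q' := Q') eA r₀ s₀ (Sum.inr a) = Sum.inl (Sum.inl (eA a, r₀)) := rfl

omit [Fintype P'] [DecidableEq P'] [Fintype Q'] [DecidableEq Q'] [Fintype R'] [DecidableEq R'] [Fintype S'] [DecidableEq S'] in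
/-- `vcToDPIdx` is injective. [folklore] -/
theorem vcToDPIdx_injective : Function.Injective (vcToDPIdx (Q' := Q') eA r₀ s₀) := by
  rintro (a | a) (b | b) h
  · simp only [vcToDPIdx_inl, Sum.inr.injEq, Sum.inl.injEq, Prod.mk.injEq, eA.injective.eq_iff, and_true] at h
    rw [h]
  · simp only [vcToDPIdx_inl, vcToDPIdx_inr, reduceCtorEq] at h
  · simp only [vcToDPIdx_inl, vcToDPIdx_inr, reduceCtorEq] at h
  · simp only [vcToDPIdx_inr, Sum.inl.injEq, Prod.mk.injEq, eA.injective.eq_iff, and_true] at h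
    rw [h]

omit [Fintype P'] [DecidableEq P'] [Fintype Q'] [DecidableEq Q'] [Fintype R'] [DecidableEq R'] [Fintype S'] [DecidableEq S'] in
/-- In the census slot (`Q' = ∅`, `R' = {r₀}`, `S' = {s₀}`) every variable of the slot is a `vcToDPIdx`-image. [folklore] -/
theorem vcToDPIdx_surjective [IsEmpty Q'] [Unique R'] [Unique S'] : Function.Surjective (vcToDPIdx (Q' := Q') eA r₀ s₀) := by
  rintro ((⟨p, r⟩ | ⟨q, _⟩) | (⟨p, s⟩ | ⟨q, _⟩))
  · exact ⟨Sum.inr (eA.symm p), by rw [vcToDPIdx_inr, eA.apply_symm_apply, Unique.eq_default r, Unique.eq_default r₀]⟩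
  · exact isEmptyElim q
  · exact ⟨Sum.inl (eA.symm p), by rw [vcToDPIdx_inl, eA.apply_symm_apply, Unique.eq_default s, Unique.eq_default s₀]⟩
  · exact isEmptyElim q

/-- **the pairing of the slot** `P_slot = Σ_p z_p w_p = Σ_p X_{(p,r₀)} X_{(p,s₀)}`. -/
def slotPairing : MvPolynomial (DPIdx P' Q' R' S') ℂ :=
  ∑ p : P', X (Sum.inl (Sum.inl (p, r₀))) * X (Sum.inr (Sum.inl (p, s₀)))

omit [DecidableEq P'] [Fintype Q'] [DecidableEq Q'] [Fintype R'] [DecidableEq R'] [Fintype S'] [DecidableEq S'] in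
/-- the tree's pairing `Σ_a z_a w_a` renames to the slot pairing. [folklore] -/
theorem rename_vcToDPIdx_pairing : rename (vcToDPIdx (Q' := Q') eA r₀ s₀) (pairing ℂ n) = slotPairing (Q' := Q') r₀ s₀ := by
  simp only [pairing, slotPairing, map_sum, map_mul, rename_X, vcToDPIdx_inl, vcToDPIdx_inr]
  rw [← eA.sum_comp]
  exact Finset.sum_congr rfl fun a _ => mul_comm _ _

omit [DecidableEq P'] [Fintype Q'] [DecidableEq Q'] [Fintype R'] [DecidableEq R'] [Fintype S'] [DecidableEq S'] in
/-- … and so do its powers. [folklore] -/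
theorem rename_vcToDPIdx_pairing_pow (k : ℕ) :
    rename (vcToDPIdx (Q' := Q') eA r₀ s₀) (pairing ℂ n ^ k) = slotPairing (Q' := Q') r₀ s₀ ^ k := by
  rw [map_pow, rename_vcToDPIdx_pairing]

/-! ## §2 The `K_V`-letter as a matrix on `Fin n` -/

/-- the `V`-letter `a` reindexed by `eA` and TRANSPOSED: `(vcMatrix eA a) i i' = a (eA i') (eA i)` (the transpose converts Konno–Konno's
column convention of `linSubst (dualPairι k)⋆` into the tree's row convention of `linSubst (vcBlock g)`). -/
def vcMatrix (a : Matrix P' P' ℂ) : Matrix (Fin n) (Fin n) ℂ := fun i i' => a (eA i') (eA i)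

/-- the inverse bookkeeping: a matrix on `Fin n` as a `V`-letter. -/
def ofVCMatrix (g : Matrix (Fin n) (Fin n) ℂ) : Matrix P' P' ℂ := fun p p' => g (eA.symm p') (eA.symm p)

omit [Fintype P'] [DecidableEq P'] in
/-- (Ported verbatim from the HodgeCMPerL package; no docstring in the source.) -/
@[simp] theorem vcMatrix_ofVCMatrix (g : Matrix (Fin n) (Fin n) ℂ) : vcMatrix eA (ofVCMatrix eA g) = g := by
  funext i i'
  simp only [vcMatrix, ofVCMatrix, Equiv.symm_apply_apply]

omit [Fintype P'] [DecidableEq P'] in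
/-- `vcMatrix eA a = (a.submatrix eA eA)ᵀ`. [folklore] -/
theorem vcMatrix_eq (a : Matrix P' P' ℂ) : vcMatrix eA a = (a.submatrix eA eA)ᵀ := rfl

omit [Fintype P'] [DecidableEq P'] in
/-- `ofVCMatrix eA g = (g.submatrix eA.symm eA.symm)ᵀ`. [folklore] -/
theorem ofVCMatrix_eq (g : Matrix (Fin n) (Fin n) ℂ) : ofVCMatrix eA g = (g.submatrix eA.symm eA.symm)ᵀ := rfl

/-- reindexing by an equivalence preserves unitarity. [folklore] -/
theorem submatrix_equiv_mem_unitaryGroup {ι κ : Type} [Fintype ι] [DecidableEq ι] [Fintype κ] [DecidableEq κ] (e : κ ≃ ι)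
    {A : Matrix ι ι ℂ} (hA : A ∈ Matrix.unitaryGroup ι ℂ) : A.submatrix e e ∈ Matrix.unitaryGroup κ ℂ := by
  rw [Matrix.mem_unitaryGroup_iff'] at hA ⊢
  rw [Matrix.star_eq_conjTranspose, Matrix.conjTranspose_submatrix, ← Matrix.star_eq_conjTranspose,
    Matrix.submatrix_mul_equiv, hA, Matrix.submatrix_one_equiv]

/-- transposed reindexing preserves unitarity. [folklore] -/
theorem transpose_submatrix_mem_unitaryGroup {ι κ : Type} [Fintype ι] [DecidableEq ι] [Fintype κ] [DecidableEq κ] (e : κ ≃ ι)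
    {A : Matrix ι ι ℂ} (hA : A ∈ Matrix.unitaryGroup ι ℂ) : (A.submatrix e e)ᵀ ∈ Matrix.unitaryGroup κ ℂ :=
  Matrix.transpose_mem_unitaryGroup_iff.mpr (submatrix_equiv_mem_unitaryGroup e hA)

/-- `vcMatrix eA a ∈ U(n)` for `a ∈ U(P')`. [folklore] -/
theorem vcMatrix_mem_unitaryGroup (a : Matrix.unitaryGroup P' ℂ) : vcMatrix eA (a : Matrix P' P' ℂ) ∈ Matrix.unitaryGroup (Fin n) ℂ :=
  transpose_submatrix_mem_unitaryGroup eA a.2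

/-- `ofVCMatrix eA g ∈ U(P')` for `g ∈ U(n)`. [folklore] -/
theorem ofVCMatrix_mem_unitaryGroup (g : Matrix.unitaryGroup (Fin n) ℂ) : ofVCMatrix eA (g : Matrix (Fin n) (Fin n) ℂ) ∈ Matrix.unitaryGroup P' ℂ :=
  transpose_submatrix_mem_unitaryGroup eA.symm g.2

/-! ## §3 The dictionary -/

/-- entry of `linSubst (dualPairι k)⋆` on a same-sign variable `X_{(p,r)}` for a general letter. [folklore] -/
theorem linSubst_star_dualPairι_X_inl_inl (k : DPK P' Q' R' S') (p : P') (r : R') :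
    linSubst (star ((dualPairι k : Matrix.unitaryGroup (DPIdx P' Q' R' S') ℂ) :
        Matrix (DPIdx P' Q' R' S') (DPIdx P' Q' R' S') ℂ)) (X (Sum.inl (Sum.inl (p, r)))) =
      ∑ p' : P', ∑ r' : R', C ((k.1.1 : Matrix P' P' ℂ) p' p * (k.2.1 : Matrix R' R' ℂ) r' r) * X (Sum.inl (Sum.inl (p', r'))) := by
  rw [linSubst_X, coe_dualPairι]
  simp only [Fintype.sum_sum_type, Fintype.sum_prod_type, Matrix.star_apply, Matrix.fromBlocks_apply₁₁,
    Matrix.fromBlocks_apply₂₁, Matrix.map_apply, Matrix.kroneckerMap_apply, star_mul', star_star, Matrix.zero_apply,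
    star_zero, map_zero, zero_mul, Finset.sum_const_zero, add_zero]

/-- entry of `linSubst (dualPairι k)⋆` on a mixed variable `X_{(p,s)}` for a general letter. [folklore] -/
theorem linSubst_star_dualPairι_X_inr_inl (k : DPK P' Q' R' S') (p : P') (s : S') :
    linSubst (star ((dualPairι k : Matrix.unitaryGroup (DPIdx P' Q' R' S') ℂ) :
        Matrix (DPIdx P' Q' R' S') (DPIdx P' Q' R' S') ℂ)) (X (Sum.inr (Sum.inl (p, s)))) =
      ∑ p' : P', ∑ s' : S', C (star ((k.1.1 : Matrix P' P' ℂ) p' p) * star ((k.2.2 : Matrix S' S' ℂ) s' s)) *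
        X (Sum.inr (Sum.inl (p', s'))) := by
  rw [linSubst_X, coe_dualPairι]
  simp only [Fintype.sum_sum_type, Fintype.sum_prod_type, Matrix.star_apply, Matrix.fromBlocks_apply₁₂,
    Matrix.fromBlocks_apply₂₂, Matrix.fromBlocks_apply₁₁, Matrix.fromBlocks_apply₂₁, Matrix.kroneckerMap_apply, star_mul',
    Matrix.zero_apply, star_zero, map_zero, zero_mul, Finset.sum_const_zero, zero_add, add_zero]

/-- the `K_V`-letter on a same-sign variable: `X_{(p,r)} ↦ Σ_{p'} a_{p'p} X_{(p',r)}`. [folklore] -/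
theorem linSubst_star_dualPairι_kV_X_inl_inl (a : Matrix.unitaryGroup P' ℂ) (b : Matrix.unitaryGroup Q' ℂ) (p : P') (r : R') :
    linSubst (star ((dualPairι (((a, b), (1, 1)) : DPK P' Q' R' S') : Matrix.unitaryGroup (DPIdx P' Q' R' S') ℂ) :
        Matrix (DPIdx P' Q' R' S') (DPIdx P' Q' R' S') ℂ)) (X (Sum.inl (Sum.inl (p, r)))) =
      ∑ p' : P', C ((a : Matrix P' P' ℂ) p' p) * X (Sum.inl (Sum.inl (p', r))) := by
  rw [linSubst_star_dualPairι_X_inl_inl]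
  refine Finset.sum_congr rfl fun p' _ => ?_
  rw [Finset.sum_eq_single r]
  · rw [OneMemClass.coe_one, Matrix.one_apply_eq, mul_one]
  · intro r' _ hr'
    rw [OneMemClass.coe_one, Matrix.one_apply_ne hr', mul_zero, C_0, zero_mul]
  · intro h; exact absurd (Finset.mem_univ r) h

/-- the `K_V`-letter on a mixed variable: `X_{(p,s)} ↦ Σ_{p'} conj(a_{p'p}) X_{(p',s)}`. [folklore] -/
theorem linSubst_star_dualPairι_kV_X_inr_inl (a : Matrix.unitaryGroup P' ℂ) (b : Matrix.unitaryGroup Q' ℂ) (p : P') (s : S') :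
    linSubst (star ((dualPairι (((a, b), (1, 1)) : DPK P' Q' R' S') : Matrix.unitaryGroup (DPIdx P' Q' R' S') ℂ) :
        Matrix (DPIdx P' Q' R' S') (DPIdx P' Q' R' S') ℂ)) (X (Sum.inr (Sum.inl (p, s)))) =
      ∑ p' : P', C (star ((a : Matrix P' P' ℂ) p' p)) * X (Sum.inr (Sum.inl (p', s))) := by
  rw [linSubst_star_dualPairι_X_inr_inl]
  refine Finset.sum_congr rfl fun p' _ => ?_
  rw [Finset.sum_eq_single s]
  · rw [OneMemClass.coe_one, Matrix.one_apply_eq, star_one, mul_one]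
  · intro s' _ hs'
    rw [OneMemClass.coe_one, Matrix.one_apply_ne hs', star_zero, mul_zero, C_0, zero_mul]
  · intro h; exact absurd (Finset.mem_univ s) h

/-- **THE DICTIONARY**: Konno–Konno's `K_V`-letter on the renamed tree polynomial IS the tree's vector–covector substitution by
`vcMatrix eA a` (`z ↦ ḡz`, `w ↦ gw` with `g = (a∘eA)ᵀ`). [Folland1989, Prop. (4.39); GoodmanWallachGTM255, §5.2.1] -/
theorem linSubst_star_dualPairι_kV_rename_vcToDPIdx (a : Matrix.unitaryGroup P' ℂ) (b : Matrix.unitaryGroup Q' ℂ)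
    (F : MvPolynomial (VCVar n) ℂ) :
    linSubst (star ((dualPairι (((a, b), (1, 1)) : DPK P' Q' R' S') : Matrix.unitaryGroup (DPIdx P' Q' R' S') ℂ) :
        Matrix (DPIdx P' Q' R' S') (DPIdx P' Q' R' S') ℂ)) (rename (vcToDPIdx eA r₀ s₀) F) =
      rename (vcToDPIdx eA r₀ s₀) (linSubst (vcBlock (vcMatrix eA (a : Matrix P' P' ℂ))) F) := by
  suffices h : (linSubst (star ((dualPairι (((a, b), (1, 1)) : DPK P' Q' R' S') : Matrix.unitaryGroup (DPIdx P' Q' R' S') ℂ) :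
        Matrix (DPIdx P' Q' R' S') (DPIdx P' Q' R' S') ℂ))).comp (rename (vcToDPIdx eA r₀ s₀)) =
      (rename (vcToDPIdx eA r₀ s₀)).comp (linSubst (vcBlock (vcMatrix eA (a : Matrix P' P' ℂ)))) from
    DFunLike.congr_fun h F
  refine MvPolynomial.algHom_ext fun v => ?_
  rcases v with c | c
  · rw [AlgHom.comp_apply, AlgHom.comp_apply, rename_X, vcToDPIdx_inl, linSubst_star_dualPairι_kV_X_inr_inl,
      linSubst_vcBlock_X_inl, map_sum]
    simp only [map_mul, rename_C, rename_X, vcToDPIdx_inl, vcMatrix, Complex.star_def]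
    exact (eA.sum_comp fun p' => C (conj ((a : Matrix P' P' ℂ) p' (eA c))) * X (Sum.inr (Sum.inl (p', s₀)))).symm
  · rw [AlgHom.comp_apply, AlgHom.comp_apply, rename_X, vcToDPIdx_inr, linSubst_star_dualPairι_kV_X_inl_inl,
      linSubst_vcBlock_X_inr, map_sum]
    simp only [map_mul, rename_C, rename_X, vcToDPIdx_inr, vcMatrix]
    exact (eA.sum_comp fun p' => C ((a : Matrix P' P' ℂ) p' (eA c)) * X (Sum.inl (Sum.inl (p', r₀)))).symm

/-! ## §4 The invariant Fock polynomials of the slot are `ℂ[P]` -/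

/-- `ℂ[P_slot]` is `K_V`-invariant: `linSubst (dualPairι ((a,b),(1,1)))⋆ (P_slot^k) = P_slot^k`. [folklore] -/
theorem linSubst_star_dualPairι_kV_slotPairing_pow (a : Matrix.unitaryGroup P' ℂ) (b : Matrix.unitaryGroup Q' ℂ) (k : ℕ) :
    linSubst (star ((dualPairι (((a, b), (1, 1)) : DPK P' Q' R' S') : Matrix.unitaryGroup (DPIdx P' Q' R' S') ℂ) :
        Matrix (DPIdx P' Q' R' S') (DPIdx P' Q' R' S') ℂ)) (slotPairing r₀ s₀ ^ k) = slotPairing r₀ s₀ ^ k := by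
  have h := isVCUnitaryInvariant_pairing_pow (n := Fintype.card P') k
    ⟨vcMatrix (Fintype.equivFin P').symm (a : Matrix P' P' ℂ), vcMatrix_mem_unitaryGroup (Fintype.equivFin P').symm a⟩
  rw [Subtype.coe_mk] at h
  rw [← rename_vcToDPIdx_pairing_pow (Fintype.equivFin P').symm, linSubst_star_dualPairι_kV_rename_vcToDPIdx, h]

/-- … hence so is every element of `span {P_slot^k}`. [folklore] -/
theorem linSubst_star_dualPairι_kV_of_mem_span (a : Matrix.unitaryGroup P' ℂ) (b : Matrix.unitaryGroup Q' ℂ)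
    {G : MvPolynomial (DPIdx P' Q' R' S') ℂ} (hG : G ∈ Submodule.span ℂ (Set.range fun k : ℕ => slotPairing (Q' := Q') r₀ s₀ ^ k)) :
    linSubst (star ((dualPairι (((a, b), (1, 1)) : DPK P' Q' R' S') : Matrix.unitaryGroup (DPIdx P' Q' R' S') ℂ) :
        Matrix (DPIdx P' Q' R' S') (DPIdx P' Q' R' S') ℂ)) G = G := by
  induction hG using Submodule.span_induction with
  | mem x hx =>
    obtain ⟨k, rfl⟩ := hx
    exact linSubst_star_dualPairι_kV_slotPairing_pow r₀ s₀ a b k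
  | zero => exact map_zero _
  | add x y _ _ hx hy => rw [map_add, hx, hy]
  | smul c x _ hx => rw [map_smul, hx]

/-- **a `K_V`-invariant Fock polynomial in the image of the slot variables is in `ℂ[P_slot]`** (transfer of the tree's FFT
`isVCUnitaryInvariant_iff` through the dictionary; `vcToDPIdx` injective). [GoodmanWallachGTM255, Thm 5.2.1] -/
theorem mem_span_slotPairing_pow_of_kV_invariant [NeZero n] (F : MvPolynomial (VCVar n) ℂ)
    (hinv : ∀ a : Matrix.unitaryGroup P' ℂ,
      linSubst (star ((dualPairι (((a, (1 : Matrix.unitaryGroup Q' ℂ)), (1, 1)) : DPK P' Q' R' S') :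
          Matrix.unitaryGroup (DPIdx P' Q' R' S') ℂ) : Matrix (DPIdx P' Q' R' S') (DPIdx P' Q' R' S') ℂ))
        (rename (vcToDPIdx eA r₀ s₀) F) = rename (vcToDPIdx eA r₀ s₀) F) :
    rename (vcToDPIdx eA r₀ s₀) F ∈ Submodule.span ℂ (Set.range fun k : ℕ => slotPairing (Q' := Q') r₀ s₀ ^ k) := by
  have hF : IsVCUnitaryInvariant F := fun g => by
    have h := hinv ⟨ofVCMatrix eA (g : Matrix (Fin n) (Fin n) ℂ), ofVCMatrix_mem_unitaryGroup eA g⟩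
    rw [linSubst_star_dualPairι_kV_rename_vcToDPIdx, Subtype.coe_mk, vcMatrix_ofVCMatrix] at h
    exact rename_injective _ (vcToDPIdx_injective eA r₀ s₀) h
  have h2 : rename (vcToDPIdx eA r₀ s₀) F ∈
      (Submodule.span ℂ (Set.range fun k : ℕ => pairing ℂ n ^ k)).map (rename (vcToDPIdx (Q' := Q') eA r₀ s₀)).toLinearMap :=
    Submodule.mem_map_of_mem ((isVCUnitaryInvariant_iff F).mp hF)
  rw [Submodule.map_span, ← Set.range_comp] at h2
  have hr : ((rename (vcToDPIdx (Q' := Q') eA r₀ s₀)).toLinearMap ∘ fun k : ℕ => pairing ℂ n ^ k) =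
      fun k : ℕ => slotPairing (Q' := Q') r₀ s₀ ^ k :=
    funext fun k => rename_vcToDPIdx_pairing_pow eA r₀ s₀ k
  rw [hr] at h2
  exact h2

/-- **THE `K_V`-INVARIANT FOCK POLYNOMIALS OF THE CENSUS SLOT ARE `ℂ[P]`** (`Q' = ∅`, `R' = {r₀}`, `S' = {s₀}`, `P' ≃ Fin n`, `n ≥ 1`):
`(∀ a ∈ U(P'), linSubst (dualPairι ((a,1),(1,1)))⋆ G = G) ↔ G ∈ span {P_slot^k}` — pv12's printed `span{P^k}` is the whole invariant part.
[GoodmanWallachGTM255, Thm 5.2.1; Folland1989, Prop. (4.39)] -/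
theorem kV_invariant_iff_mem_span_slotPairing_pow [Nonempty P'] [IsEmpty Q'] [Unique R'] [Unique S']
    (G : MvPolynomial (DPIdx P' Q' R' S') ℂ) :
    (∀ a : Matrix.unitaryGroup P' ℂ,
      linSubst (star ((dualPairι (((a, (1 : Matrix.unitaryGroup Q' ℂ)), (1, 1)) : DPK P' Q' R' S') :
          Matrix.unitaryGroup (DPIdx P' Q' R' S') ℂ) : Matrix (DPIdx P' Q' R' S') (DPIdx P' Q' R' S') ℂ)) G = G) ↔
      G ∈ Submodule.span ℂ (Set.range fun k : ℕ => slotPairing (Q' := Q') r₀ s₀ ^ k) := by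
  haveI : NeZero (Fintype.card P') := ⟨Fintype.card_ne_zero⟩
  constructor
  · intro h
    obtain ⟨F, rfl⟩ := exists_rename_eq_of_vars_subset_range G (vcToDPIdx (Q' := Q') (Fintype.equivFin P').symm r₀ s₀)
      (vcToDPIdx_injective (Fintype.equivFin P').symm r₀ s₀) fun v _ => vcToDPIdx_surjective (Fintype.equivFin P').symm r₀ s₀ v
    exact mem_span_slotPairing_pow_of_kV_invariant (Fintype.equivFin P').symm r₀ s₀ F h
  · intro hG a
    exact linSubst_star_dualPairι_kV_of_mem_span r₀ s₀ a 1 hG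

end Slot

end HodgeCM.Model.HypCensus

end
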